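import Mathlib.Geometry.Manifold.ContMDiff.Defs
import Mathlib.Geometry.Euclidean.Volume.Measure
import Mathlib.Analysis.Calculus.ContDiff.RCLike
import HarnessLib

/-!
# `C¹` images of compact subsets of manifolds have finite Hausdorff measure

Topic `Literature/MeasureTheory/Hausdorff` (namespace `Literature.MeasureTheory.Hausdorff`).
Let `M` be a manifold (charted space, any model with corners `I` on a finite-dimensional real
normed space `E`, no `IsManifold` hypothesis needed), `F` a real normed space and `f : M → F` a
map which is `C¹` (in the manifold sense, `ContMDiffAt I 𝓘(ℝ, F) 1`) at every point of a compact
set `K ⊆ M`. Then for every natural number `d ≥ dim E`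

* `hausdorffMeasure_image_lt_top_of_isCompact` — `μH[d] (f '' K) < ∞`;
* `hausdorffMeasure_range_lt_top` — for compact `M` and `C¹` `f`, `μH[d] (range f) < ∞`;
* `euclideanHausdorffMeasure_image_lt_top_of_isCompact`, `euclideanHausdorffMeasure_range_lt_top`
  — the same for Mathlib's Euclidean-normalised Hausdorff measure `μHE[d]` when `F` is a
  finite-dimensional inner product space.

In particular the image `ι(M) ⊆ ℝⁿ⁺¹` of a closed `n`-manifold under a `C¹` map (e.g. a closed
embedded hypersurface) has finite `n`-dimensional area `μHE[n] (range ι) < ∞`, the first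
ingredient of the finiteness of its Gaussian areas and Colding–Minicozzi entropy
(`Literature.Geometry.Riemannian.gaussianArea_le_mul_measure`; Colding–Minicozzi 2012,
Lemma 7.2).

Proof (Federer, *Geometric Measure Theory*, 2.10.11: "If `f` is a Lipschitzian map … then
`(Lip f)^m · 𝓗^m(A) ≥ ∫ N(f|A, y) d𝓗^m y`", in particular `𝓗^m(f(A)) ≤ (Lip f)^m 𝓗^m(A)`;
Mathlib's `LipschitzOnWith.hausdorffMeasure_image_le`): read in the extended chart at `x ∈ K`,
`f ∘ (extChartAt I x)⁻¹` is `C¹` within the convex set `range I` at the image of `x`, hence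
Lipschitz on a neighbourhood `t` of it within `range I` (`ContDiffWithinAt.exists_lipschitzOnWith`),
which may be taken bounded; bounded subsets of `E` have finite `μH[d]` for `d ≥ dim E`
(`μH[dim E]` is an additive Haar measure, `μH[d] = 0` on `E` for `d > dim E`); so `f` maps the
neighbourhood `(extChartAt I x)⁻¹(t)` of `x` onto a set of finite measure, and finitely many such
neighbourhoods cover `K` (`IsCompact.induction_on`). The intrinsic counterpart (compact subsets of
a Riemannian manifold have finite Hausdorff measure for the length metric) is the tree's
`Literature.Geometry.Lorentzian.hausdorffMeasure_lt_top_of_isCompact` (`VolumeProofs.lean`), whose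
bounded-set lemma is re-proved here privately to keep the import cone measure-theoretic.

Everything is proved; no definitions and no named facts are introduced.

## References

* H. Federer, *Geometric Measure Theory*, Springer (1969), 2.10.11 (Hausdorff measure under
  Lipschitzian maps). [Federer1969]
* T. H. Colding, W. P. Minicozzi II, *Generic mean curvature flow I*, Ann. of Math. 175 (2012),
  Lemma 7.2 (finiteness of the entropy of a closed hypersurface). [ColdingMinicozzi2012]
-/

noncomputable section

open Set Function Filter Module
open _root_.MeasureTheory _root_.MeasureTheory.Measure
open scoped ENNReal NNReal Topology Manifold

namespace Literature.MeasureTheory.Hausdorff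

section Bounded

variable {E : Type*} [NormedAddCommGroup E] [NormedSpace ℝ E] [FiniteDimensional ℝ E]
  [MeasurableSpace E] [BorelSpace E]

/-- Bounded subsets of a finite-dimensional real normed space have finite `d`-dimensional
Hausdorff measure for every natural `d ≥ dim E` (`μH[dim E]` is an additive Haar measure,
finite on the compact closure; `μH[d]` vanishes identically for `d > dim E` by
`hausdorffMeasure_zero_or_top`). (Same statement as the tree's
`Literature.Geometry.Lorentzian.hausdorffMeasure_lt_top_of_isBounded`, re-proved to avoid a
Lorentzian-geometry import in a measure-theory file.) [folklore] -/
theorem hausdorffMeasure_lt_top_of_isBounded' {d : ℕ} (hd : finrank ℝ E ≤ d) {s : Set E}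
    (hs : Bornology.IsBounded s) : (μH[d] : Measure E) s < ∞ := by
  have h₁ : (μH[finrank ℝ E] : Measure E) s < ∞ :=
    (measure_mono subset_closure).trans_lt hs.isCompact_closure.measure_lt_top
  rcases hd.eq_or_lt with rfl | hlt
  · exact h₁
  · rcases hausdorffMeasure_zero_or_top (X := E)
      (show ((finrank ℝ E : ℕ) : ℝ) < (d : ℝ) by exact_mod_cast hlt) s with h | h
    · rw [h]
      exact ENNReal.zero_lt_top
    · exact absurd h h₁.ne

end Bounded

section Image

variable {E : Type*} [NormedAddCommGroup E] [NormedSpace ℝ E] [FiniteDimensional ℝ E]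
  {H : Type*} [TopologicalSpace H] {I : ModelWithCorners ℝ E H}
  {M : Type*} [TopologicalSpace M] [ChartedSpace H M]
  {F : Type*} [NormedAddCommGroup F] [NormedSpace ℝ F] [MeasurableSpace F] [BorelSpace F]

/-- **`C¹` images of compact sets have finite Hausdorff measure.** If `f : M → F` is `C¹` (in
the manifold sense) at every point of a compact set `K` of a manifold modelled on the
finite-dimensional space `E`, then `μH[d] (f '' K) < ∞` for every natural `d ≥ dim E`: locally,
in an extended chart, `f` is a Lipschitz image of a bounded subset of `E` (Federer 2.10.11:
`𝓗^d(f(A)) ≤ (Lip f)^d 𝓗^d(A)`), and finitely many chart neighbourhoods cover `K`.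
[cite: Federer1969, 2.10.11] -/
theorem hausdorffMeasure_image_lt_top_of_isCompact {f : M → F} {K : Set M} (hK : IsCompact K)
    (hf : ∀ x ∈ K, ContMDiffAt I 𝓘(ℝ, F) 1 f x) {d : ℕ} (hd : finrank ℝ E ≤ d) :
    (μH[d] : Measure F) (f '' K) < ∞ := by
  borelize E
  refine hK.induction_on (p := fun s => (μH[d] : Measure F) (f '' s) < ∞) ?_ ?_ ?_ ?_
  · simp
  · intro s t hst ht
    exact (measure_mono (image_mono hst)).trans_lt ht
  · intro s t hs ht
    rw [image_union]
    exact (measure_union_le _ _).trans_lt (ENNReal.add_lt_top.2 ⟨hs, ht⟩)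
  · intro x hx
    set φ := extChartAt I x with hφ
    obtain ⟨-, hdiff⟩ := (contMDiffAt_iff.1 (hf x hx))
    obtain ⟨C, t, ht, hlip⟩ := hdiff.exists_lipschitzOnWith I.convex_range
    set t' := t ∩ Metric.ball (φ x) 1 with ht'_def
    have ht' : t' ∈ 𝓝[range I] (φ x) :=
      inter_mem ht (mem_nhdsWithin_of_mem_nhds (Metric.ball_mem_nhds _ one_pos))
    have hlip' : LipschitzOnWith C (f ∘ φ.symm) t' := hlip.mono inter_subset_left
    have hbdd : Bornology.IsBounded t' := Metric.isBounded_ball.subset inter_subset_right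
    have hpre : φ ⁻¹' t' ∈ 𝓝 x := by
      rw [hφ, ← map_extChartAt_nhds] at ht'
      exact ht'
    refine ⟨φ.source ∩ φ ⁻¹' t', mem_nhdsWithin_of_mem_nhds
      (inter_mem (extChartAt_source_mem_nhds (I := I) x) hpre), ?_⟩
    have hsub : f '' (φ.source ∩ φ ⁻¹' t') ⊆ (f ∘ φ.symm) '' t' := by
      rintro _ ⟨y, ⟨hy, hyt⟩, rfl⟩
      exact ⟨φ y, hyt, by simp only [comp_apply, φ.left_inv hy]⟩
    calc (μH[d] : Measure F) (f '' (φ.source ∩ φ ⁻¹' t'))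
        ≤ (μH[d] : Measure F) ((f ∘ φ.symm) '' t') := measure_mono hsub
      _ ≤ (C : ℝ≥0∞) ^ (d : ℝ) * (μH[d] : Measure E) t' :=
          hlip'.hausdorffMeasure_image_le (Nat.cast_nonneg d)
      _ < ∞ := ENNReal.mul_lt_top (ENNReal.rpow_lt_top_of_nonneg (Nat.cast_nonneg d)
          ENNReal.coe_ne_top) (hausdorffMeasure_lt_top_of_isBounded' hd hbdd)

/-- **The `C¹` image of a compact manifold has finite Hausdorff measure**: for compact `M`
modelled on the finite-dimensional space `E` and a `C¹` map `f : M → F`,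
`μH[d] (range f) < ∞` for every natural `d ≥ dim E`. [cite: Federer1969, 2.10.11] -/
theorem hausdorffMeasure_range_lt_top [CompactSpace M] {f : M → F} {n : WithTop ℕ∞}
    (hf : ContMDiff I 𝓘(ℝ, F) n f) (hn : 1 ≤ n) {d : ℕ} (hd : finrank ℝ E ≤ d) :
    (μH[d] : Measure F) (range f) < ∞ := by
  rw [← image_univ]
  exact hausdorffMeasure_image_lt_top_of_isCompact isCompact_univ
    (fun x _ => (hf.of_le hn).contMDiffAt) hd

end Image

section Euclidean

variable {E : Type*} [NormedAddCommGroup E] [NormedSpace ℝ E] [FiniteDimensional ℝ E]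
  {H : Type*} [TopologicalSpace H] {I : ModelWithCorners ℝ E H}
  {M : Type*} [TopologicalSpace M] [ChartedSpace H M]
  {F : Type*} [NormedAddCommGroup F] [InnerProductSpace ℝ F] [MeasurableSpace F] [BorelSpace F]

/-- `C¹` images of compact sets have finite **Euclidean** Hausdorff measure `μHE[d]`
(Mathlib's normalisation of `μH[d]` by a finite Haar factor), `d ≥ dim E`.
[cite: Federer1969, 2.10.11] -/
theorem euclideanHausdorffMeasure_image_lt_top_of_isCompact {f : M → F} {K : Set M}
    (hK : IsCompact K) (hf : ∀ x ∈ K, ContMDiffAt I 𝓘(ℝ, F) 1 f x) {d : ℕ}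
    (hd : finrank ℝ E ≤ d) : (μHE[d] : Measure F) (f '' K) < ∞ := by
  rw [euclideanHausdorffMeasure_def, Measure.smul_apply, ENNReal.smul_def, smul_eq_mul]
  exact ENNReal.mul_lt_top ENNReal.coe_lt_top (hausdorffMeasure_image_lt_top_of_isCompact hK hf hd)

/-- **A closed manifold mapped `C¹` into a Euclidean space has image of finite area**:
for compact `M` modelled on `E` and `C^n` (`n ≥ 1`) `f : M → F`, `μHE[d] (range f) < ∞` for
`d ≥ dim E`; e.g. a closed embedded hypersurface `ι(Mⁿ) ⊆ ℝⁿ⁺¹` has `μHE[n] (range ι) < ∞`.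
[cite: Federer1969, 2.10.11] -/
theorem euclideanHausdorffMeasure_range_lt_top [CompactSpace M] {f : M → F} {n : WithTop ℕ∞}
    (hf : ContMDiff I 𝓘(ℝ, F) n f) (hn : 1 ≤ n) {d : ℕ} (hd : finrank ℝ E ≤ d) :
    (μHE[d] : Measure F) (range f) < ∞ := by
  rw [← image_univ]
  exact euclideanHausdorffMeasure_image_lt_top_of_isCompact isCompact_univ
    (fun x _ => (hf.of_le hn).contMDiffAt) hd

end Euclidean

end Literature.MeasureTheory.Hausdorff

end
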